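import Literature.AlgebraicGeometry.RelativeSpec.GeometricQuotientFreeEquivariantDescent
import Mathlib.AlgebraicGeometry.Morphisms.FlatDescent
import HarnessLib

/-!
# Free finite quotients commute with fibre products:
# `(Y₁ ×_X Y₂)/G ≅ Y₁/G ×_{X/G} Y₂/G` over a `G`-torsor `X → X/G`
# (SGA 1, Exp. VIII Cor. 7.8 / Exp. V §2; MFK94 Prop. 7.1, finite-group form)

Let the finite group `G` act on `X` over `Q` with `p : X → Q` an AFFINE geometric quotient by a FREE
action (ring condition on the affine charts, as in every free-quotient file of the tree), so that
`X → Q` is a finite étale `G`-torsor. By ★ `IsGeometricQuotient.isPullback_of_equivariant_of_free`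
(`…GeometricQuotientFreeEquivariantDescent`) every `G`-scheme `Y` with an affine geometric quotient
`Y → B` and a `G`-equivariant `f : Y → X` is the base change `Y ≅ B ×_Q X` of its quotient: descent of
`X`-schemes along the torsor is effective, `{G-schemes over X} ≃ {schemes over Q}`. An equivalence
preserves fibre products; this file proves that statement in the tree's hypothesis-only currency:

* **`isPullback_quotients_of_isPullback_of_free`** — given two such `G`-schemes `fᵢ : Yᵢ → X` with
  quotients `pᵢ : Yᵢ → Bᵢ` (over `bᵢ : Bᵢ → Q`), a third `G`-scheme `P` with quotient `p_P : P → C`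
  and projections `uᵢ : P → Yᵢ` exhibiting `P` as the FIBRE PRODUCT `Y₁ ×_X Y₂`
  (`IsPullback u₁ u₂ f₁ f₂`; `u₁` `G`-equivariant — equivariance of `u₂` is not needed), and
  morphisms `cᵢ : C → Bᵢ` under them (`uᵢ ≫ pᵢ = p_P ≫ cᵢ`, `c₁ ≫ b₁ = c₂ ≫ b₂`), the square of
  QUOTIENTS is cartesian: `IsPullback c₁ c₂ b₁ b₂`, i.e. `C ≅ B₁ ×_Q B₂`.

No action of `G` on a fibre product is constructed here: the action on `P` and the equivariance of
the projections are HYPOTHESES (as the pulled-back action is in ★ `isGeometricQuotient_baseChange_of_free`),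
so the statement applies verbatim to the diagonal action on `pullback f₁ f₂` once a consumer has it
(e.g. the group law `A ×_M A → A` of an equivariant abelian scheme over a free `Γ`-scheme `M`
descending to `A/Γ ×_{M/Γ} A/Γ → A/Γ`).

Proof: let `D := B₁ ×_Q B₂` and `κ = (c₁, c₂) : C → D`. Base-change `κ` along the flat, surjective,
quasi-compact cover `D ×_Q X → D` (a base change of the torsor `p`; ★ `flat_of_free`): the base change
is identified with `P → D ×_Q X`, `P ≅ C ×_Q X` by the effective-descent theorem applied to `P`, and
`D ×_Q X ≅ (B₁ ×_Q X) ×_X (B₂ ×_Q X) ≅ Y₁ ×_X Y₂ ≅ P` by the same theorem applied to `Y₁`, `Y₂` — an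
explicit inverse is written with `IsPullback.lift`. Hence the base change of `κ` is an isomorphism, and
isomorphisms DESCEND along flat surjective quasi-compact morphisms (Mathlib
`descendsAlong_isomorphisms_surjective_inf_flat_inf_quasicompact`), so `κ` is an isomorphism.
Everything is proved; no named facts, no definitions.

Mathlib searched (pin): `MorphismProperty.of_isPullback_of_descendsAlong`,
`AlgebraicGeometry.descendsAlong_isomorphisms_surjective_inf_flat_inf_quasicompact`,
`IsPullback.of_right`, `IsPullback.lift`/`lift_fst`/`lift_snd`/`hom_ext`, `IsPullback.of_iso_pullback`
(all used).

## References

* A. Grothendieck, *SGA 1*, Exp. VIII Cor. 7.8 (descente des schémas affines le long d'un torseur),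
  Exp. V Prop. 2.6, Déf. 2.7. [SGA1]
* D. Mumford, J. Fogarty, F. Kirwan, *Geometric Invariant Theory*, 3rd ed. (1994), Ch. 7 §1,
  Prop. 7.1 (p. 127). [MumfordFogartyKirwan1994]
* D. Mumford, *Abelian Varieties* (1970), §7 Thm. p. 66; §12 Thm. 1 (p. 112). [MumfordAV1970]
-/

noncomputable section

universe u

open CategoryTheory Limits AlgebraicGeometry TopologicalSpace Opposite

namespace Literature.AlgebraicGeometry.RelativeSpec.ActionOver.IsGeometricQuotient

variable {X Q : Scheme.{u}} {p : X ⟶ Q} {G : Type u} [Group G] [Fintype G] {ρ : ActionOver p G}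
  (hq : ρ.IsGeometricQuotient p) [IsAffineHom p]
  (hfree : ∀ (V : Q.Opens), IsAffineOpen V → ∀ g : G, g ≠ 1 →
    Ideal.span (Set.range fun b : Γ(X, p ⁻¹ᵁ V) ↦ ρ.act g V b - b) = ⊤)

set_option backward.isDefEq.respectTransparency false

include hq hfree

/-- **Free finite quotients commute with fibre products** (`(Y₁ ×_X Y₂)/G ≅ Y₁/G ×_{X/G} Y₂/G`; a
consequence of effective descent along the `G`-torsor `X → Q = X/G`, SGA 1 VIII 7.8 / [MFK94]
Prop. 7.1). Data: a free affine geometric quotient `p : X → Q` by the finite group `G`; for `i = 1, 2`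
a `G`-scheme `Yᵢ` with affine geometric quotient `pᵢ : Yᵢ → Bᵢ`, a `G`-equivariant `fᵢ : Yᵢ → X` and
`bᵢ : Bᵢ → Q` under it; a `G`-scheme `P` with affine geometric quotient `p_P : P → C` and
projections `uᵢ : P → Yᵢ` making `P` the fibre product `Y₁ ×_X Y₂`, `u₁` `G`-equivariant; and
`cᵢ : C → Bᵢ` under `uᵢ` with `c₁ ≫ b₁ = c₂ ≫ b₂`. Conclusion: the square of quotients
`(c₁, c₂; b₁, b₂)` is cartesian.
[cite: SGA1, Exp. VIII Cor. 7.8; Exp. V Prop. 2.6, Déf. 2.7]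
[cite: MumfordFogartyKirwan1994, Ch. 7 §1 Prop. 7.1 (p. 127)] -/
theorem isPullback_quotients_of_isPullback_of_free
    {Y₁ B₁ : Scheme.{u}} {p₁ : Y₁ ⟶ B₁} {ρ₁ : ActionOver p₁ G} (hq₁ : ρ₁.IsGeometricQuotient p₁)
    [IsAffineHom p₁] (f₁ : Y₁ ⟶ X) (b₁ : B₁ ⟶ Q)
    (hf₁ : ∀ g : G, (ρ₁.aut g).hom ≫ f₁ = f₁ ≫ (ρ.aut g).hom) (hsq₁ : f₁ ≫ p = p₁ ≫ b₁)
    {Y₂ B₂ : Scheme.{u}} {p₂ : Y₂ ⟶ B₂} {ρ₂ : ActionOver p₂ G} (hq₂ : ρ₂.IsGeometricQuotient p₂)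
    [IsAffineHom p₂] (f₂ : Y₂ ⟶ X) (b₂ : B₂ ⟶ Q)
    (hf₂ : ∀ g : G, (ρ₂.aut g).hom ≫ f₂ = f₂ ≫ (ρ.aut g).hom) (hsq₂ : f₂ ≫ p = p₂ ≫ b₂)
    {P C : Scheme.{u}} {pP : P ⟶ C} {ρP : ActionOver pP G} (hqP : ρP.IsGeometricQuotient pP)
    [IsAffineHom pP] (u₁ : P ⟶ Y₁) (u₂ : P ⟶ Y₂)
    (hu₁ : ∀ g : G, (ρP.aut g).hom ≫ u₁ = u₁ ≫ (ρ₁.aut g).hom)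
    (HP : IsPullback u₁ u₂ f₁ f₂)
    (c₁ : C ⟶ B₁) (c₂ : C ⟶ B₂) (hc₁ : u₁ ≫ p₁ = pP ≫ c₁) (hc₂ : u₂ ≫ p₂ = pP ≫ c₂)
    (hC : c₁ ≫ b₁ = c₂ ≫ b₂) :
    IsPullback c₁ c₂ b₁ b₂ := by
  -- the three effective-descent squares
  have H₁ : IsPullback f₁ p₁ p b₁ := hq.isPullback_of_equivariant_of_free hfree hq₁ f₁ b₁ hf₁ hsq₁
  have H₂ : IsPullback f₂ p₂ p b₂ := hq.isPullback_of_equivariant_of_free hfree hq₂ f₂ b₂ hf₂ hsq₂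
  have huf : ∀ g : G, (ρP.aut g).hom ≫ (u₁ ≫ f₁) = (u₁ ≫ f₁) ≫ (ρ.aut g).hom := fun g => by
    rw [← Category.assoc, hu₁ g, Category.assoc, hf₁ g, Category.assoc]
  have HPX : IsPullback (u₁ ≫ f₁) pP p (c₁ ≫ b₁) :=
    hq.isPullback_of_equivariant_of_free hfree hqP (u₁ ≫ f₁) (c₁ ≫ b₁) huf
      (by rw [Category.assoc, hsq₁, ← Category.assoc, hc₁, Category.assoc])
  -- `D = B₁ ×_Q B₂`, the comparison `κ : C → D`, and the cover `D' = X ×_Q D → D`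
  let d : pullback b₁ b₂ ⟶ Q := pullback.fst b₁ b₂ ≫ b₁
  obtain ⟨κ, hκ₁, hκ₂⟩ : ∃ κ : C ⟶ pullback b₁ b₂,
      κ ≫ pullback.fst b₁ b₂ = c₁ ∧ κ ≫ pullback.snd b₁ b₂ = c₂ :=
    ⟨pullback.lift c₁ c₂ hC, pullback.lift_fst _ _ _, pullback.lift_snd _ _ _⟩
  have hκd : κ ≫ d = c₁ ≫ b₁ := by simp only [d, ← Category.assoc, hκ₁]
  -- `φ : P → D' = X ×_Q D`, `φ = (u₁ ≫ f₁, p_P ≫ κ)`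
  obtain ⟨φ, hφ₁, hφ₂⟩ : ∃ φ : P ⟶ pullback p d,
      φ ≫ pullback.fst p d = u₁ ≫ f₁ ∧ φ ≫ pullback.snd p d = pP ≫ κ :=
    ⟨pullback.lift (u₁ ≫ f₁) (pP ≫ κ) (by rw [HPX.w, Category.assoc, hκd]),
      pullback.lift_fst _ _ _, pullback.lift_snd _ _ _⟩
  -- (1) the square `(φ, p_P; snd, κ)` is cartesian (pasting: the outer rectangle is `HPX`)
  have Hφ : IsPullback φ pP (pullback.snd p d) κ := by
    refine IsPullback.of_right ?_ hφ₂ (IsPullback.of_hasPullback p d)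
    rw [hφ₁, hκd]
    exact HPX
  -- (2) `φ` is an isomorphism: an explicit inverse `ψ : D' → P` through `Y₁ ×_X Y₂`
  have hd₂ : d = pullback.snd b₁ b₂ ≫ b₂ := by simp only [d, pullback.condition]
  have w₁ : pullback.fst p d ≫ p = (pullback.snd p d ≫ pullback.fst b₁ b₂) ≫ b₁ := by
    rw [pullback.condition, Category.assoc]
  have w₂ : pullback.fst p d ≫ p = (pullback.snd p d ≫ pullback.snd b₁ b₂) ≫ b₂ := by
    rw [pullback.condition, hd₂, Category.assoc]
  let y₁ : pullback p d ⟶ Y₁ := H₁.lift (pullback.fst p d) (pullback.snd p d ≫ pullback.fst b₁ b₂) w₁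
  let y₂ : pullback p d ⟶ Y₂ := H₂.lift (pullback.fst p d) (pullback.snd p d ≫ pullback.snd b₁ b₂) w₂
  have hy₁f : y₁ ≫ f₁ = pullback.fst p d := H₁.lift_fst _ _ _
  have hy₁p : y₁ ≫ p₁ = pullback.snd p d ≫ pullback.fst b₁ b₂ := H₁.lift_snd _ _ _
  have hy₂f : y₂ ≫ f₂ = pullback.fst p d := H₂.lift_fst _ _ _
  have hy₂p : y₂ ≫ p₂ = pullback.snd p d ≫ pullback.snd b₁ b₂ := H₂.lift_snd _ _ _
  let ψ : pullback p d ⟶ P := HP.lift y₁ y₂ (by rw [hy₁f, hy₂f])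
  have hψ₁ : ψ ≫ u₁ = y₁ := HP.lift_fst _ _ _
  have hψ₂ : ψ ≫ u₂ = y₂ := HP.lift_snd _ _ _
  have hφy₁ : φ ≫ y₁ = u₁ := by
    apply H₁.hom_ext
    · rw [Category.assoc, hy₁f, hφ₁]
    · rw [Category.assoc, hy₁p, ← Category.assoc, hφ₂, Category.assoc, hκ₁, hc₁]
  have hφy₂ : φ ≫ y₂ = u₂ := by
    apply H₂.hom_ext
    · rw [Category.assoc, hy₂f, hφ₁, HP.w]
    · rw [Category.assoc, hy₂p, ← Category.assoc, hφ₂, Category.assoc, hκ₂, hc₂]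
  have h₁ : φ ≫ ψ = 𝟙 P := by
    apply HP.hom_ext
    · rw [Category.assoc, hψ₁, hφy₁, Category.id_comp]
    · rw [Category.assoc, hψ₂, hφy₂, Category.id_comp]
  have h₂ : ψ ≫ φ = 𝟙 (pullback p d) := by
    apply pullback.hom_ext
    · rw [Category.assoc, hφ₁, ← Category.assoc, hψ₁, hy₁f, Category.id_comp]
    · rw [Category.assoc, hφ₂, ← Category.assoc, Category.id_comp]
      apply pullback.hom_ext
      · rw [Category.assoc, Category.assoc, hκ₁, ← hc₁, ← Category.assoc, hψ₁, hy₁p]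
      · rw [Category.assoc, Category.assoc, hκ₂, ← hc₂, ← Category.assoc, hψ₂, hy₂p]
  have hφiso : IsIso φ := ⟨ψ, h₁, h₂⟩
  -- (3) isomorphisms descend along the flat surjective quasi-compact cover `D' → D`
  haveI : Flat p := hq.flat_of_free hfree
  haveI : Surjective p := ⟨hq.surjective⟩
  haveI : QuasiCompact p := hq.quasiCompact
  haveI hκiso : IsIso κ := by
    have hcov : (@Surjective ⊓ @Flat ⊓ @QuasiCompact : MorphismProperty Scheme.{u})
        (pullback.snd p d) := ⟨⟨inferInstance, inferInstance⟩, inferInstance⟩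
    exact (MorphismProperty.isomorphisms.iff _).mp
      (MorphismProperty.of_isPullback_of_descendsAlong
        (P := MorphismProperty.isomorphisms Scheme.{u})
        (Q := @Surjective ⊓ @Flat ⊓ @QuasiCompact) Hφ hcov
        ((MorphismProperty.isomorphisms.iff _).mpr hφiso))
  -- (4) conclude
  exact IsPullback.of_iso_pullback ⟨hC⟩ (asIso κ) hκ₁ hκ₂

end Literature.AlgebraicGeometry.RelativeSpec.ActionOver.IsGeometricQuotient

end
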